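import Literature.Computability.QuantumComplexity.SLPCodesTrunc
import HarnessLib

/-!
# The register compiler on codes for parametric expressions with external arithmetic leaves

Topic `Literature/Computability/QuantumComplexity`; third member of the family `CoreDescSLPCodes.lean` (affine leaves) /
`SLPCodesTrunc.lean` (truncated-affine leaves), for the UNIFORMITY of Regev's sampler ([Regev2009, Lemma 3.14, proof]; Arora–Barak
§6.2): the controlled-phase program `SLP.qftPhaseB k Tre Tim` of the Fourier stage has the sub-expressions `constE (k+1) T` whose SHAPE
depends on the data `T` (`ConstEFP.lean` computes their compiled programs on codes directly). We therefore let parametric expressions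
carry EXTERNAL arithmetic leaves `ext j` (`j : Fin m`), read a CONTEXT `c : σ` (the precision is `kOf c`), instantiate `ext j` by
`A j c : SLP.AExpr`, and prove the compiler polynomial-time on codes GIVEN on-codes compilers of the external leaves
(`hA j : (c, 1ʳ) ↦ (A j c).compile (thrWd (kOf c)) r`) — the same structural induction as `PA3.codeFP`/`PB3.codeFP`:

* `AJLCore.PAX m`, `PBX m`, `PAX.inst kOf A c`, `PBX.inst kOf A c`; input codes `inAX ctxE = (c, 1ʳ)`, `inBX ctxE = (c, 1ʳ, 1ᵠ)`;
* **`AJLCore.PAX.codeFP`**, **`AJLCore.PBX.codeFP hk hA pb : CodeFP (inBX ctxE) outBE (fun t => (pb.inst kOf A t.1).compile (thrWd (kOf t.1)) t.2.1 t.2.2)`**;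
* `AJLCore.PBX.compile_inst_codeFP : CodeFP ctxE outBE (fun c => (pb.inst kOf A c).compile (thrWd (kOf c)) 0 0)`.

USE (successor): `qftPhaseB k Tre Tim` is `PBX.inst kOf A c` for the context `c = (k, Tre, Tim)`, `m = 2`, `A 0 c = constE (k+1) Tre`,
`A 1 c = constE (k+1) Tim` (`ltConstB k (k+1) T = .lt (aE k) (constE (k+1) T)`; `phaseSignB`, `qftCtlB`, `iteB`, `bitB`, `thr0B`, `trueB` are
fixed shapes as in `GRLevelProgFP.lean`), with `hA` from `SLP.constE_compile_codeFP` (`ConstEFP.lean`).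

Everything is proved; no named fact is introduced.

## References

* O. Regev, J. ACM 56(6) (2009), Lemma 3.14 (proof) [Regev2009].
* S. Arora, B. Barak, *Computational Complexity: A Modern Approach*, CUP 2009, §1.3 and §6.2 [AroraBarak2009].
* D. Aharonov, V. Jones, Z. Landau, Algorithmica 55 (2009), §3.3 [AharonovJonesLandau2009].
-/

noncomputable section

namespace Literature.Computability.QuantumComplexity

open _root_.Computability Complexity Complexity.CodeFP SLP

namespace AJLCore

/-! ### Parametric expressions with external arithmetic leaves -/

/-- Parametric arithmetic expressions with truncated-affine leaves and `m` external leaves. [folklore] -/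
inductive PAX (m : ℕ)
  /-- an external arithmetic sub-expression -/
  | ext (j : Fin m)
  /-- the input field -/
  | fld (off len : Aff3)
  /-- the constant `2^i` -/
  | pw (i : Aff3)
  /-- `e₁ + e₂·2^sh` -/
  | add (e₁ e₂ : PAX m) (sh : Aff3)
  /-- `e₁·e₂` -/
  | mul (e₁ e₂ : PAX m)

/-- Parametric Boolean expressions over `PAX m`. [folklore] -/
inductive PBX (m : ℕ)
  /-- `e₁ < e₂` -/
  | lt (e₁ e₂ : PAX m)
  /-- negation -/
  | not (b : PBX m)
  /-- conjunction -/
  | and (b₁ b₂ : PBX m)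
  /-- disjunction -/
  | or (b₁ b₂ : PBX m)

section Inst

variable {σ : Type} {m : ℕ} (kOf : σ → ℕ) (A : Fin m → σ → AExpr)

/-- The instance of a parametric arithmetic expression with external leaves at the context `c`. [folklore] -/
def PAX.inst (c : σ) : PAX m → AExpr
  | .ext j => A j c
  | .fld off len => .fld (off.ev (kOf c)) (len.ev (kOf c))
  | .pw i => .pw (i.ev (kOf c))
  | .add e₁ e₂ sh => .add (e₁.inst c) (e₂.inst c) (sh.ev (kOf c))
  | .mul e₁ e₂ => .mul (e₁.inst c) (e₂.inst c)

/-- The instance of a parametric Boolean expression with external leaves at the context `c`. [folklore] -/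
def PBX.inst (c : σ) : PBX m → BExpr
  | .lt e₁ e₂ => .lt (e₁.inst kOf A c) (e₂.inst kOf A c)
  | .not b => .not (b.inst c)
  | .and b₁ b₂ => .and (b₁.inst c) (b₂.inst c)
  | .or b₁ b₂ => .or (b₁.inst c) (b₂.inst c)

end Inst

/-- The input code of the arithmetic compiler with a context: `(c, 1ʳ)`. [folklore] -/
abbrev inAX {σ : Type} (ctxE : σ → List Bool) : σ × ℕ → List Bool := pairE ctxE unE

/-- The input code of the Boolean compiler with a context: `(c, 1ʳ, 1ᵠ)`. [folklore] -/
abbrev inBX {σ : Type} (ctxE : σ → List Bool) : σ × ℕ × ℕ → List Bool := pairE ctxE (pairE unE unE)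

section Ext

variable {σ : Type} {ctxE : σ → List Bool} {m : ℕ} {kOf : σ → ℕ} {A : Fin m → σ → AExpr}
  (hk : CodeFP ctxE unE kOf) (hA : ∀ j, CodeFP (inAX ctxE) outAE (fun t => (A j t.1).compile (thrWd (kOf t.1)) t.2))

include hk hA

/-! ### The compiler on truncated-affine parametric expressions with a context and external leaves (verbatim `PA3.codeFP` / `PB3.codeFP`) -/

/-- **The arithmetic compiler in polynomial time** on truncated-affine expressions: `(1ᵏ, 1ʳ) ↦ (pe.inst k).compile (4k+16) r`.
[cite: AroraBarak2009, §1.3] -/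
theorem PAX.codeFP : ∀ pe : PAX m, CodeFP (inAX ctxE) outAE (fun t => (pe.inst kOf A t.1).compile (thrWd (kOf t.1)) t.2)
  | .ext j => (hA j).congr fun _ => rfl
  | .fld off len => by
    have h : CodeFP (inAX ctxE) outAE (fun t => ([Instr.copyIn t.2 (off.ev (kOf t.1)) (len.ev (kOf t.1))], t.2, t.2 + 1)) := (
      ((rawSingleton instrE).comp (instr_copyIn (natOfUn.comp (snd _ _)) ((affNat3 off).comp (hk.comp (fst _ _))) ((affUn3 len).comp (hk.comp (fst _ _))))).pair
        ((snd _ _).pair (unSucc.comp (snd _ _))) :)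
    exact h.congr fun t => rfl
  | .pw i => by
    have h : CodeFP (inAX ctxE) outAE (fun t => ([Instr.setBit t.2 (i.ev (kOf t.1))], t.2, t.2 + 1)) := (
      ((rawSingleton instrE).comp (instr_setBit (natOfUn.comp (snd _ _)) ((affNat3 i).comp (hk.comp (fst _ _))))).pair ((snd _ _).pair (unSucc.comp (snd _ _))) :)
    exact h.congr fun t => rfl
  | .add e₁ e₂ sh => by
    have H1 : CodeFP (inAX ctxE) outAE (fun t => (e₁.inst kOf A t.1).compile (thrWd (kOf t.1)) t.2) := (PAX.codeFP e₁ :)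
    have H2 : CodeFP (inAX ctxE) outAE (fun t => (e₂.inst kOf A t.1).compile (thrWd (kOf t.1)) ((e₁.inst kOf A t.1).compile (thrWd (kOf t.1)) t.2).2.2) := (
      (PAX.codeFP e₂).comp ((fst _ _).pair H1.snd'.snd') :)
    have h : CodeFP (inAX ctxE) outAE (fun t =>
        (((e₁.inst kOf A t.1).compile (thrWd (kOf t.1)) t.2).1 ++ ((e₂.inst kOf A t.1).compile (thrWd (kOf t.1)) ((e₁.inst kOf A t.1).compile (thrWd (kOf t.1)) t.2).2.2).1 ++
          [Instr.add ((e₂.inst kOf A t.1).compile (thrWd (kOf t.1)) ((e₁.inst kOf A t.1).compile (thrWd (kOf t.1)) t.2).2.2).2.2 ((e₁.inst kOf A t.1).compile (thrWd (kOf t.1)) t.2).2.1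
            ((e₂.inst kOf A t.1).compile (thrWd (kOf t.1)) ((e₁.inst kOf A t.1).compile (thrWd (kOf t.1)) t.2).2.2).2.1 (sh.ev (kOf t.1))],
        ((e₂.inst kOf A t.1).compile (thrWd (kOf t.1)) ((e₁.inst kOf A t.1).compile (thrWd (kOf t.1)) t.2).2.2).2.2,
        ((e₂.inst kOf A t.1).compile (thrWd (kOf t.1)) ((e₁.inst kOf A t.1).compile (thrWd (kOf t.1)) t.2).2.2).2.2 + 1)) := (
      ((rawAppend instrE).comp (((rawAppend instrE).comp (H1.fst'.pair H2.fst')).pair ((rawSingleton instrE).comp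
        (instr_add (natOfUn.comp H2.snd'.snd') (natOfUn.comp H1.snd'.fst') (natOfUn.comp H2.snd'.fst') ((affNat3 sh).comp (hk.comp (fst _ _))))))).pair
        (H2.snd'.snd'.pair (unSucc.comp H2.snd'.snd')) :)
    exact h.congr fun t => rfl
  | .mul e₁ e₂ => by
    have H1 : CodeFP (inAX ctxE) outAE (fun t => (e₁.inst kOf A t.1).compile (thrWd (kOf t.1)) t.2) := (PAX.codeFP e₁ :)
    have H2 : CodeFP (inAX ctxE) outAE (fun t => (e₂.inst kOf A t.1).compile (thrWd (kOf t.1)) ((e₁.inst kOf A t.1).compile (thrWd (kOf t.1)) t.2).2.2) := (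
      (PAX.codeFP e₂).comp ((fst _ _).pair H1.snd'.snd') :)
    have hW : CodeFP (inAX ctxE) unE (fun t => 2 * thrWd (kOf t.1)) := ((affUn 8 32).comp (hk.comp (fst _ _))).congr fun t => by simp [thrWd]; ring
    have h : CodeFP (inAX ctxE) outAE (fun t =>
        (((e₁.inst kOf A t.1).compile (thrWd (kOf t.1)) t.2).1 ++ ((e₂.inst kOf A t.1).compile (thrWd (kOf t.1)) ((e₁.inst kOf A t.1).compile (thrWd (kOf t.1)) t.2).2.2).1 ++
          mulInstrs (thrWd (kOf t.1)) ((e₂.inst kOf A t.1).compile (thrWd (kOf t.1)) ((e₁.inst kOf A t.1).compile (thrWd (kOf t.1)) t.2).2.2).2.2 ((e₁.inst kOf A t.1).compile (thrWd (kOf t.1)) t.2).2.1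
            ((e₂.inst kOf A t.1).compile (thrWd (kOf t.1)) ((e₁.inst kOf A t.1).compile (thrWd (kOf t.1)) t.2).2.2).2.1,
        ((e₂.inst kOf A t.1).compile (thrWd (kOf t.1)) ((e₁.inst kOf A t.1).compile (thrWd (kOf t.1)) t.2).2.2).2.2 + 2 * thrWd (kOf t.1),
        ((e₂.inst kOf A t.1).compile (thrWd (kOf t.1)) ((e₁.inst kOf A t.1).compile (thrWd (kOf t.1)) t.2).2.2).2.2 + 2 * thrWd (kOf t.1) + 1)) := (
      ((rawAppend instrE).comp (((rawAppend instrE).comp (H1.fst'.pair H2.fst')).pair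
        (mulInstrs_codeFP.comp ((hk.comp (fst _ _)).pair ((natOfUn.comp H2.snd'.snd').pair ((natOfUn.comp H1.snd'.fst').pair (natOfUn.comp H2.snd'.fst'))))))).pair
        ((unAdd.comp (H2.snd'.snd'.pair hW)).pair (unSucc.comp (unAdd.comp (H2.snd'.snd'.pair hW)))) :)
    exact h.congr fun t => rfl

/-- **The Boolean compiler in polynomial time** on truncated-affine expressions: `(1ᵏ, 1ʳ, 1ᵠ) ↦ (pb.inst k).compile (4k+16) r φ`.
[cite: AroraBarak2009, §1.3] [cite: Regev2009, Lemma 3.14 (proof)] -/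
theorem PBX.codeFP : ∀ pb : PBX m, CodeFP (inBX ctxE) outBE (fun t => (pb.inst kOf A t.1).compile (thrWd (kOf t.1)) t.2.1 t.2.2)
  | .lt e₁ e₂ => by
    have H1 : CodeFP (inBX ctxE) outAE (fun t => (e₁.inst kOf A t.1).compile (thrWd (kOf t.1)) t.2.1) := ((PAX.codeFP hk hA e₁).comp ((fst _ _).pair (snd _ _).fst') :)
    have H2 : CodeFP (inBX ctxE) outAE (fun t => (e₂.inst kOf A t.1).compile (thrWd (kOf t.1)) ((e₁.inst kOf A t.1).compile (thrWd (kOf t.1)) t.2.1).2.2) := (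
      (PAX.codeFP hk hA e₂).comp ((fst _ _).pair H1.snd'.snd') :)
    have hφ : CodeFP (inBX ctxE) unE (fun t => t.2.2) := ((snd _ _).snd' :)
    have h : CodeFP (inBX ctxE) outBE (fun t =>
        (((e₁.inst kOf A t.1).compile (thrWd (kOf t.1)) t.2.1).1 ++ ((e₂.inst kOf A t.1).compile (thrWd (kOf t.1)) ((e₁.inst kOf A t.1).compile (thrWd (kOf t.1)) t.2.1).2.2).1 ++
          [Instr.lt t.2.2 ((e₁.inst kOf A t.1).compile (thrWd (kOf t.1)) t.2.1).2.1 ((e₂.inst kOf A t.1).compile (thrWd (kOf t.1)) ((e₁.inst kOf A t.1).compile (thrWd (kOf t.1)) t.2.1).2.2).2.1],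
        t.2.2, ((e₂.inst kOf A t.1).compile (thrWd (kOf t.1)) ((e₁.inst kOf A t.1).compile (thrWd (kOf t.1)) t.2.1).2.2).2.2, t.2.2 + 1)) := (
      ((rawAppend instrE).comp (((rawAppend instrE).comp (H1.fst'.pair H2.fst')).pair ((rawSingleton instrE).comp
        (instr_lt (natOfUn.comp hφ) (natOfUn.comp H1.snd'.fst') (natOfUn.comp H2.snd'.fst'))))).pair (hφ.pair (H2.snd'.snd'.pair (unSucc.comp hφ))) :)
    exact h.congr fun t => rfl
  | .not b => by
    have H : CodeFP (inBX ctxE) outBE (fun t => (b.inst kOf A t.1).compile (thrWd (kOf t.1)) t.2.1 t.2.2) := (PBX.codeFP b :)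
    have h : CodeFP (inBX ctxE) outBE (fun t =>
        (((b.inst kOf A t.1).compile (thrWd (kOf t.1)) t.2.1 t.2.2).1 ++ [Instr.fnot ((b.inst kOf A t.1).compile (thrWd (kOf t.1)) t.2.1 t.2.2).2.2.2 ((b.inst kOf A t.1).compile (thrWd (kOf t.1)) t.2.1 t.2.2).2.1],
        ((b.inst kOf A t.1).compile (thrWd (kOf t.1)) t.2.1 t.2.2).2.2.2, ((b.inst kOf A t.1).compile (thrWd (kOf t.1)) t.2.1 t.2.2).2.2.1, ((b.inst kOf A t.1).compile (thrWd (kOf t.1)) t.2.1 t.2.2).2.2.2 + 1)) := (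
      ((rawAppend instrE).comp (H.fst'.pair ((rawSingleton instrE).comp (instr_fnot (natOfUn.comp H.snd'.snd'.snd') (natOfUn.comp H.snd'.fst'))))).pair
        (H.snd'.snd'.snd'.pair (H.snd'.snd'.fst'.pair (unSucc.comp H.snd'.snd'.snd'))) :)
    exact h.congr fun t => rfl
  | .and b₁ b₂ => by
    have H1 : CodeFP (inBX ctxE) outBE (fun t => (b₁.inst kOf A t.1).compile (thrWd (kOf t.1)) t.2.1 t.2.2) := (PBX.codeFP b₁ :)
    have H2 : CodeFP (inBX ctxE) outBE (fun t => (b₂.inst kOf A t.1).compile (thrWd (kOf t.1)) ((b₁.inst kOf A t.1).compile (thrWd (kOf t.1)) t.2.1 t.2.2).2.2.1 ((b₁.inst kOf A t.1).compile (thrWd (kOf t.1)) t.2.1 t.2.2).2.2.2) := (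
      (PBX.codeFP b₂).comp ((fst _ _).pair (H1.snd'.snd'.fst'.pair H1.snd'.snd'.snd')) :)
    have h : CodeFP (inBX ctxE) outBE (fun t =>
        (((b₁.inst kOf A t.1).compile (thrWd (kOf t.1)) t.2.1 t.2.2).1 ++ ((b₂.inst kOf A t.1).compile (thrWd (kOf t.1)) ((b₁.inst kOf A t.1).compile (thrWd (kOf t.1)) t.2.1 t.2.2).2.2.1 ((b₁.inst kOf A t.1).compile (thrWd (kOf t.1)) t.2.1 t.2.2).2.2.2).1 ++
          [Instr.fand ((b₂.inst kOf A t.1).compile (thrWd (kOf t.1)) ((b₁.inst kOf A t.1).compile (thrWd (kOf t.1)) t.2.1 t.2.2).2.2.1 ((b₁.inst kOf A t.1).compile (thrWd (kOf t.1)) t.2.1 t.2.2).2.2.2).2.2.2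
            ((b₁.inst kOf A t.1).compile (thrWd (kOf t.1)) t.2.1 t.2.2).2.1 ((b₂.inst kOf A t.1).compile (thrWd (kOf t.1)) ((b₁.inst kOf A t.1).compile (thrWd (kOf t.1)) t.2.1 t.2.2).2.2.1 ((b₁.inst kOf A t.1).compile (thrWd (kOf t.1)) t.2.1 t.2.2).2.2.2).2.1],
        ((b₂.inst kOf A t.1).compile (thrWd (kOf t.1)) ((b₁.inst kOf A t.1).compile (thrWd (kOf t.1)) t.2.1 t.2.2).2.2.1 ((b₁.inst kOf A t.1).compile (thrWd (kOf t.1)) t.2.1 t.2.2).2.2.2).2.2.2,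
        ((b₂.inst kOf A t.1).compile (thrWd (kOf t.1)) ((b₁.inst kOf A t.1).compile (thrWd (kOf t.1)) t.2.1 t.2.2).2.2.1 ((b₁.inst kOf A t.1).compile (thrWd (kOf t.1)) t.2.1 t.2.2).2.2.2).2.2.1,
        ((b₂.inst kOf A t.1).compile (thrWd (kOf t.1)) ((b₁.inst kOf A t.1).compile (thrWd (kOf t.1)) t.2.1 t.2.2).2.2.1 ((b₁.inst kOf A t.1).compile (thrWd (kOf t.1)) t.2.1 t.2.2).2.2.2).2.2.2 + 1)) := (
      ((rawAppend instrE).comp (((rawAppend instrE).comp (H1.fst'.pair H2.fst')).pair ((rawSingleton instrE).comp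
        (instr_fand (natOfUn.comp H2.snd'.snd'.snd') (natOfUn.comp H1.snd'.fst') (natOfUn.comp H2.snd'.fst'))))).pair
        (H2.snd'.snd'.snd'.pair (H2.snd'.snd'.fst'.pair (unSucc.comp H2.snd'.snd'.snd'))) :)
    exact h.congr fun t => rfl
  | .or b₁ b₂ => by
    have H1 : CodeFP (inBX ctxE) outBE (fun t => (b₁.inst kOf A t.1).compile (thrWd (kOf t.1)) t.2.1 t.2.2) := (PBX.codeFP b₁ :)
    have H2 : CodeFP (inBX ctxE) outBE (fun t => (b₂.inst kOf A t.1).compile (thrWd (kOf t.1)) ((b₁.inst kOf A t.1).compile (thrWd (kOf t.1)) t.2.1 t.2.2).2.2.1 ((b₁.inst kOf A t.1).compile (thrWd (kOf t.1)) t.2.1 t.2.2).2.2.2) := (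
      (PBX.codeFP b₂).comp ((fst _ _).pair (H1.snd'.snd'.fst'.pair H1.snd'.snd'.snd')) :)
    have h : CodeFP (inBX ctxE) outBE (fun t =>
        (((b₁.inst kOf A t.1).compile (thrWd (kOf t.1)) t.2.1 t.2.2).1 ++ ((b₂.inst kOf A t.1).compile (thrWd (kOf t.1)) ((b₁.inst kOf A t.1).compile (thrWd (kOf t.1)) t.2.1 t.2.2).2.2.1 ((b₁.inst kOf A t.1).compile (thrWd (kOf t.1)) t.2.1 t.2.2).2.2.2).1 ++
          [Instr.forr ((b₂.inst kOf A t.1).compile (thrWd (kOf t.1)) ((b₁.inst kOf A t.1).compile (thrWd (kOf t.1)) t.2.1 t.2.2).2.2.1 ((b₁.inst kOf A t.1).compile (thrWd (kOf t.1)) t.2.1 t.2.2).2.2.2).2.2.2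
            ((b₁.inst kOf A t.1).compile (thrWd (kOf t.1)) t.2.1 t.2.2).2.1 ((b₂.inst kOf A t.1).compile (thrWd (kOf t.1)) ((b₁.inst kOf A t.1).compile (thrWd (kOf t.1)) t.2.1 t.2.2).2.2.1 ((b₁.inst kOf A t.1).compile (thrWd (kOf t.1)) t.2.1 t.2.2).2.2.2).2.1],
        ((b₂.inst kOf A t.1).compile (thrWd (kOf t.1)) ((b₁.inst kOf A t.1).compile (thrWd (kOf t.1)) t.2.1 t.2.2).2.2.1 ((b₁.inst kOf A t.1).compile (thrWd (kOf t.1)) t.2.1 t.2.2).2.2.2).2.2.2,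
        ((b₂.inst kOf A t.1).compile (thrWd (kOf t.1)) ((b₁.inst kOf A t.1).compile (thrWd (kOf t.1)) t.2.1 t.2.2).2.2.1 ((b₁.inst kOf A t.1).compile (thrWd (kOf t.1)) t.2.1 t.2.2).2.2.2).2.2.1,
        ((b₂.inst kOf A t.1).compile (thrWd (kOf t.1)) ((b₁.inst kOf A t.1).compile (thrWd (kOf t.1)) t.2.1 t.2.2).2.2.1 ((b₁.inst kOf A t.1).compile (thrWd (kOf t.1)) t.2.1 t.2.2).2.2.2).2.2.2 + 1)) := (
      ((rawAppend instrE).comp (((rawAppend instrE).comp (H1.fst'.pair H2.fst')).pair ((rawSingleton instrE).comp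
        (instr_forr (natOfUn.comp H2.snd'.snd'.snd') (natOfUn.comp H1.snd'.fst') (natOfUn.comp H2.snd'.fst'))))).pair
        (H2.snd'.snd'.snd'.pair (H2.snd'.snd'.fst'.pair (unSucc.comp H2.snd'.snd'.snd'))) :)
    exact h.congr fun t => rfl


omit hk hA in
/-- The compiler output of one parametric program at `r = φ = 0`, from the context. [folklore] -/
theorem PBX.compile_inst_codeFP (hk : CodeFP ctxE unE kOf) (hA : ∀ j, CodeFP (inAX ctxE) outAE (fun t => (A j t.1).compile (thrWd (kOf t.1)) t.2))
    (pb : PBX m) : CodeFP ctxE outBE (fun c => (pb.inst kOf A c).compile (thrWd (kOf c)) 0 0) :=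
  ((PBX.codeFP hk hA pb).comp ((CodeFP.id ctxE).pair ((const ctxE 0).pair (const ctxE 0)))).congr fun _ => rfl

end Ext

end AJLCore

end Literature.Computability.QuantumComplexity

end
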